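import Summits.HodgeConjecture.HodgeConjecture.Theorems.HeckePrymWeilHeckePrymAnchorsOfGlobalActionOnly
import Literature.AlgebraicGeometry.HodgeTheory.WeilFamilyKAction
import HarnessLib

/-!
# `HeckePrymAnchors` modulo ONE named fact: Deligne's abelian scheme with `𝒪_K`-action, charts only (item stmt-HodgeConjecture-14496, route HeckePrymWeil)

Line `Sketch`, v15 (continuation lead c9): the crux `HeckePrymAnchors` of route `HeckePrymWeil`
derived from the single named fact registered as the stub of the line's skeleton
(`Cruxes/HeckePrymAnchors/Lines/Sketch.lean`: `stub_weilFamilyKAction`):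

* `HodgeTheory.deligne1982_weilFamily_kAction` (`HodgeTheory/WeilFamilyKAction`;
  [Deligne1982HodgeCycles], proof of Thm. 4.8, p. 48, clauses (b), (c), and p. 50: the abelian
  scheme with `𝒪_K`-action through `X` with fibrewise charts by abelian `2k`-folds with `√-p`, a
  CM/tensor fibre, and the flatness of the Weil class — clause (a), balanced Weil type of every
  fibre, being the tree's THEOREM `deligne1982_weilFamily_globalAction_of_kAction`, from
  `HodgeTheory/WeilFamilyBalanced`).

The proof is the composition of `deligne1982_weilFamily_globalAction_of_kAction` with the landed
one-fact closure `heckePrymAnchors_of_globalAction` (p120402). No `sorry`, no definition, no new axiom.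
-/

noncomputable section

-- every declaration of this problem lives in `Summit.HodgeConjecture.HodgeConjecture.…` (summit = sub-problem)
set_option linter.dupNamespace false

open CategoryTheory AlgebraicGeometry Limits MonoidalCategory CartesianMonoidalCategory

namespace Summit.HodgeConjecture.HodgeConjecture.Theorems.HeckePrymWeilLine

open Literature.AlgebraicGeometry Literature.AlgebraicGeometry.Motives Literature.AlgebraicGeometry.HodgeTheory
open Summit.HodgeConjecture.HodgeConjecture.Theses.HeckePrymWeil

/-- **`HeckePrymAnchors` from Deligne's abelian scheme with `𝒪_K`-action, charts only.** The crux
of route `HeckePrymWeil` follows from the one named fact `HodgeTheory.deligne1982_weilFamily_kAction`: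
balanced Weil type of every fibre is the tree's theorem
`deligne1982_weilFamily_globalAction_of_kAction`, and the landed one-fact closure
`heckePrymAnchors_of_globalAction` concludes.
[cite: Deligne1982HodgeCycles, proof of Thm. 4.8 (pp. 47–52) with Prop. 4.4]
[cite: vanGeemen1994HodgeAV, Lemma 5.2 (4)] -/
theorem heckePrymAnchors_of_kAction :
    (deligne1982_weilFamily_kAction) → Summit.HodgeConjecture.HodgeConjecture.Theses.HeckePrymWeil.HeckePrymAnchors :=
  fun hKA => heckePrymAnchors_of_globalAction (deligne1982_weilFamily_globalAction_of_kAction hKA)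

end Summit.HodgeConjecture.HodgeConjecture.Theorems.HeckePrymWeilLine

end
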